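import Summits.CriticalPhenomena.PercolationContinuityZ3.Theorems.PercNearOneGluingNoHeavyPcintChordMemZ6B10Defs
import HarnessLib

/-!
# PCINT lane, kernel reduced-state B3r certificate `Z6B10` (bond, d = 6, memory τ = 10, 6192 state classes): row checks 10 (rows [5400, 6000))

Cell `prim-pcint`, seat `prim-pcint-2` (gen 4); memo `run/shared/lean/prim/pcint/REDUCTIONS.md` §B3r and HANDOFF ("B3r on reduced states").
Does NOT build on p205010.  Data for `BondK.le_criticalProb_of_checkRowsB` (`…PcintChordMemKernelCert`): `p = 9290/100000`,
`s̄ = 99568/100000` (`s̄²+p² ≥ 1`), refund `r = 100434/100000` (`s̄·r ≥ 1`, `(1-p)·r ≤ 1`), `κ̄ = (100000+99568)/(2·100000)`, `λ = 99999/100000`;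
Collatz–Wielandt weights (scale 10⁹) from a power iteration (ρ ≈ 0.9997074), exact off-line max row ratio 0.9997073741 < λ.
Generated by work/gen/gen_b3r_kernel.py (prim-pcint-2 gen 4 folder; copy in run/shared/lean/prim/pcint/prim-pcint-2/kernel/); the kernel re-checks every row.
-/

namespace Summit.CriticalPhenomena.PercolationContinuityZ3.Theorems.Pcint.ChordMemZ6B10

set_option maxHeartbeats 0 in
/-- Rows `[5400, 5500)` pass the check. [folklore] -/
theorem chk_5400 : WinK.allRange (BondK.checkRowB 10 6 6192 9290 100434 99568 100000 99999 100000 ChordMemZ6B10.syms ChordMemZ6B10.tree) 5400 5500 = true :=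
  WinK.allRange_of_allRangeB (fuel := 8) (lo := 5400) (len := 100) (by decide +kernel)

set_option maxHeartbeats 0 in
/-- Rows `[5500, 5600)` pass the check. [folklore] -/
theorem chk_5500 : WinK.allRange (BondK.checkRowB 10 6 6192 9290 100434 99568 100000 99999 100000 ChordMemZ6B10.syms ChordMemZ6B10.tree) 5500 5600 = true :=
  WinK.allRange_of_allRangeB (fuel := 8) (lo := 5500) (len := 100) (by decide +kernel)

set_option maxHeartbeats 0 in
/-- Rows `[5600, 5700)` pass the check. [folklore] -/
theorem chk_5600 : WinK.allRange (BondK.checkRowB 10 6 6192 9290 100434 99568 100000 99999 100000 ChordMemZ6B10.syms ChordMemZ6B10.tree) 5600 5700 = true :=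
  WinK.allRange_of_allRangeB (fuel := 8) (lo := 5600) (len := 100) (by decide +kernel)

set_option maxHeartbeats 0 in
/-- Rows `[5700, 5800)` pass the check. [folklore] -/
theorem chk_5700 : WinK.allRange (BondK.checkRowB 10 6 6192 9290 100434 99568 100000 99999 100000 ChordMemZ6B10.syms ChordMemZ6B10.tree) 5700 5800 = true :=
  WinK.allRange_of_allRangeB (fuel := 8) (lo := 5700) (len := 100) (by decide +kernel)

set_option maxHeartbeats 0 in
/-- Rows `[5800, 5900)` pass the check. [folklore] -/
theorem chk_5800 : WinK.allRange (BondK.checkRowB 10 6 6192 9290 100434 99568 100000 99999 100000 ChordMemZ6B10.syms ChordMemZ6B10.tree) 5800 5900 = true :=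
  WinK.allRange_of_allRangeB (fuel := 8) (lo := 5800) (len := 100) (by decide +kernel)

set_option maxHeartbeats 0 in
/-- Rows `[5900, 6000)` pass the check. [folklore] -/
theorem chk_5900 : WinK.allRange (BondK.checkRowB 10 6 6192 9290 100434 99568 100000 99999 100000 ChordMemZ6B10.syms ChordMemZ6B10.tree) 5900 6000 = true :=
  WinK.allRange_of_allRangeB (fuel := 8) (lo := 5900) (len := 100) (by decide +kernel)

/-- Rows `[5400, 6000)` pass the check. [folklore] -/
theorem file_10 : WinK.allRange (BondK.checkRowB 10 6 6192 9290 100434 99568 100000 99999 100000 ChordMemZ6B10.syms ChordMemZ6B10.tree) 5400 6000 = true := (WinK.allRange_split (WinK.allRange_split (WinK.allRange_split (WinK.allRange_split (WinK.allRange_split chk_5400 chk_5500) chk_5600) chk_5700) chk_5800) chk_5900)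

end Summit.CriticalPhenomena.PercolationContinuityZ3.Theorems.Pcint.ChordMemZ6B10
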